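import Summits.Ventures.DiscreteObjects.PP12.OrderElevenCollineation

/-!
# PP(12), order-11 cell, Case A (`NoHomologyArray12`): the NORMAL FORM of a homology array
Framing: lottery ticket; floor = certified bounds/negative ranges.

Cell pub-namedobj (venture DiscreteObjects), target (M), designs gen 22 (P11-SIZING.md). `NoHomologyArray12` says that no
`d : Fin 13 → Fin 13 → ZMod 11` satisfies `QdmRows 11 13 d` (an `(11,13;1,1;1)` quasi-difference matrix with diagonal holes =
a projective plane of order 12 with a cyclic `(C,l)`-homology group of order 11, `OrderElevenHomology`). The symmetries of
`QdmRows` — column constants, row constants, simultaneous relabelling of the indices, unit multipliers — give the normal form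
searched by the engines (HOME/code/collin/caseA.c; designs g22 code/p11): after making row `0` and column `0` zero and dropping
them, a `12 × 12` array `a` over `ZMod 11` (hole at `i = j`) with row `0` SORTED (`a 0 j + 1 = j`), rows injective off the hole,
and for any two rows the differences off the two holes non-zero and pairwise distinct (`IsNormal`). Main statement:
**`noHomologyArray12_of_normal : (∀ a, ¬ IsNormal a) → NoHomologyArray12`** — the kernel certificate (to come) refutes `IsNormal`.
No `sorry`, no new axioms; nothing here asserts a census statement.
-/

namespace Summit.Ventures.DiscreteObjects.PP12

namespace Homology12

/-! ### symmetries of `QdmRows` -/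

/-- adding a constant to every column and a constant to every row preserves `QdmRows` -/
theorem qdmRows_shift {m k : ℕ} {d : Fin k → Fin k → ZMod m} (h : QdmRows m k d) (c r : Fin k → ZMod m) :
    QdmRows m k (fun i j => d i j + c j + r i) := by
  intro i i' hii' j j' hjj' hji hji' hj'i hj'i' e
  apply h i i' hii' j j' hjj' hji hji' hj'i hj'i'
  have e1 : d i j + c j + r i - (d i' j + c j + r i') = d i j - d i' j + (r i - r i') := by ring
  have e2 : d i j' + c j' + r i - (d i' j' + c j' + r i') = d i j' - d i' j' + (r i - r i') := by ring
  rw [e1, e2] at e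
  exact add_right_cancel e

/-- relabelling rows and columns by the same permutation preserves `QdmRows` -/
theorem qdmRows_relabel {m k : ℕ} {d : Fin k → Fin k → ZMod m} (h : QdmRows m k d) (σ : Fin k ≃ Fin k) :
    QdmRows m k (fun i j => d (σ i) (σ j)) := by
  intro i i' hii' j j' hjj' hji hji' hj'i hj'i'
  exact h (σ i) (σ i') (σ.injective.ne hii') (σ j) (σ j') (σ.injective.ne hjj') (σ.injective.ne hji) (σ.injective.ne hji')
    (σ.injective.ne hj'i) (σ.injective.ne hj'i')

/-- scaling by a non-zero residue preserves `QdmRows` over `ZMod 11` -/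
theorem qdmRows_scale {k : ℕ} {d : Fin k → Fin k → ZMod 11} (h : QdmRows 11 k d) {u : ZMod 11} (hu : u ≠ 0) :
    QdmRows 11 k (fun i j => u * d i j) := by
  haveI : Fact (Nat.Prime 11) := ⟨by norm_num⟩
  intro i i' hii' j j' hjj' hji hji' hj'i hj'i' e
  apply h i i' hii' j j' hjj' hji hji' hj'i hj'i'
  have : u * (d i j - d i' j) = u * (d i j' - d i' j') := by rw [mul_sub, mul_sub]; exact e
  exact mul_left_cancel₀ hu this

/-! ### the normal form -/

/-- **normal form of a homology array** (indices `1..12` of the `13 × 13` array after the zero row / column `0` is dropped;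
the hole of row `i` is at `j = i`): row `0` sorted, rows injective off the hole, row differences off the holes non-zero and distinct -/
structure IsNormal (a : Fin 12 → Fin 12 → ZMod 11) : Prop where
  /-- row `0` is `(·, 0, 1, …, 10)`: `a 0 j + 1 = j` -/
  row0 : ∀ j : Fin 12, j ≠ 0 → a 0 j + 1 = ((j : ℕ) : ZMod 11)
  /-- each row is injective off its hole -/
  latin : ∀ i j j' : Fin 12, j ≠ i → j' ≠ i → j ≠ j' → a i j ≠ a i j'
  /-- entries of two different rows in a common column differ -/
  ne_of_ne : ∀ i i' j : Fin 12, i ≠ i' → j ≠ i → j ≠ i' → a i j ≠ a i' j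
  /-- the differences of two different rows over their common columns are pairwise distinct -/
  diff_ne : ∀ i i' : Fin 12, i ≠ i' → ∀ j j' : Fin 12, j ≠ j' → j ≠ i → j ≠ i' → j' ≠ i → j' ≠ i' → a i j - a i' j ≠ a i j' - a i' j'

/-- the zero-bordered array: subtract row `0` from every row and then column `0` from every column -/
def border (d : Fin 13 → Fin 13 → ZMod 11) (i j : Fin 13) : ZMod 11 := d i j + (-d 0 j) + (-d i 0 + d 0 0)

/-- the bordered array still satisfies `QdmRows` -/
theorem qdmRows_border {d : Fin 13 → Fin 13 → ZMod 11} (h : QdmRows 11 13 d) : QdmRows 11 13 (border d) :=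
  qdmRows_shift h (fun j => -d 0 j) (fun i => -d i 0 + d 0 0)

/-- row `0` of the bordered array vanishes -/
theorem border_row0 (d : Fin 13 → Fin 13 → ZMod 11) (j : Fin 13) : border d 0 j = 0 := by
  simp [border]

/-- column `0` of the bordered array vanishes -/
theorem border_col0 (d : Fin 13 → Fin 13 → ZMod 11) (i : Fin 13) : border d i 0 = 0 := by
  simp only [border]; ring

/-- in a zero-bordered array, row `1` is injective off `{0, 1}` -/
theorem row1_injective {e : Fin 13 → Fin 13 → ZMod 11} (h : QdmRows 11 13 e) (h0 : ∀ j, e 0 j = 0) {j j' : Fin 13}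
    (hj0 : j ≠ 0) (hj1 : j ≠ 1) (hj'0 : j' ≠ 0) (hj'1 : j' ≠ 1) (hjj' : j ≠ j') : e 1 j ≠ e 1 j' := by
  have := h 1 0 (by decide) j j' hjj' hj1 hj0 hj'1 hj'0
  rwa [h0 j, h0 j', sub_zero, sub_zero] at this

/-- the sorting map of a zero-bordered array: `0 ↦ 0`, `1 ↦ 1`, `j ↦ (e 1 j) + 2` -/
def sortMap (e : Fin 13 → Fin 13 → ZMod 11) (j : Fin 13) : Fin 13 :=
  if j = 0 then 0 else if j = 1 then 1 else ⟨(e 1 j).val + 2, by have := (e 1 j).val_lt; omega⟩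

/-- the sorting map is injective -/
theorem sortMap_injective {e : Fin 13 → Fin 13 → ZMod 11} (h : QdmRows 11 13 e) (h0 : ∀ j, e 0 j = 0) : Function.Injective (sortMap e) := by
  intro j j' hjj'
  unfold sortMap at hjj'
  by_cases hj0 : j = 0
  · subst hj0
    by_cases hj'0 : j' = 0
    · exact hj'0.symm
    · by_cases hj'1 : j' = 1
      · subst hj'1; simp at hjj'
      · rw [if_pos rfl, if_neg hj'0, if_neg hj'1] at hjj'; exact absurd (congrArg Fin.val hjj') (by simp)
  · by_cases hj1 : j = 1
    · subst hj1
      by_cases hj'0 : j' = 0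
      · subst hj'0; simp at hjj'
      · by_cases hj'1 : j' = 1
        · exact hj'1.symm
        · rw [if_neg (by decide), if_pos rfl, if_neg hj'0, if_neg hj'1] at hjj'; exact absurd (congrArg Fin.val hjj') (by simp)
    · rw [if_neg hj0, if_neg hj1] at hjj'
      by_cases hj'0 : j' = 0
      · subst hj'0; rw [if_pos rfl] at hjj'; exact absurd (congrArg Fin.val hjj') (by simp)
      · by_cases hj'1 : j' = 1
        · subst hj'1; rw [if_neg (by decide), if_pos rfl] at hjj'; exact absurd (congrArg Fin.val hjj') (by simp)
        · rw [if_neg hj'0, if_neg hj'1] at hjj'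
          have hv : (e 1 j).val = (e 1 j').val := by have := congrArg Fin.val hjj'; simpa using this
          by_contra hne
          exact row1_injective h h0 hj0 hj1 hj'0 hj'1 hne (ZMod.val_injective 11 hv)

/-- the sorting permutation (inverse of the sorting map) -/
noncomputable def sortPerm {e : Fin 13 → Fin 13 → ZMod 11} (h : QdmRows 11 13 e) (h0 : ∀ j, e 0 j = 0) : Fin 13 ≃ Fin 13 :=
  (Equiv.ofBijective (sortMap e) ((sortMap_injective h h0).bijective_of_finite)).symm

/-- the sorting permutation fixes `0` -/
theorem sortPerm_zero {e : Fin 13 → Fin 13 → ZMod 11} (h : QdmRows 11 13 e) (h0 : ∀ j, e 0 j = 0) : sortPerm h h0 0 = 0 := by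
  rw [sortPerm, Equiv.symm_apply_eq]; rfl

/-- the sorting permutation fixes `1` -/
theorem sortPerm_one {e : Fin 13 → Fin 13 → ZMod 11} (h : QdmRows 11 13 e) (h0 : ∀ j, e 0 j = 0) : sortPerm h h0 1 = 1 := by
  rw [sortPerm, Equiv.symm_apply_eq]; rfl

/-- after sorting, row `1` reads `j − 2` at every `j ∉ {0, 1}`: `e 1 (σ j) + 2 = j` -/
theorem row1_sorted {e : Fin 13 → Fin 13 → ZMod 11} (h : QdmRows 11 13 e) (h0 : ∀ j, e 0 j = 0) {j : Fin 13} (hj0 : j ≠ 0) (hj1 : j ≠ 1) :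
    ((e 1 (sortPerm h h0 j)).val : ℕ) + 2 = (j : ℕ) := by
  set j0 := sortPerm h h0 j with hj0def
  have hfj : sortMap e j0 = j := by
    rw [hj0def, sortPerm]; exact Equiv.ofBijective_apply_symm_apply _ _ _
  have hj00 : j0 ≠ 0 := fun hz => by rw [hz] at hfj; simp [sortMap] at hfj; exact hj0 hfj.symm
  have hj01 : j0 ≠ 1 := fun hz => by rw [hz] at hfj; simp [sortMap] at hfj; exact hj1 hfj.symm
  unfold sortMap at hfj
  rw [if_neg hj00, if_neg hj01] at hfj
  have := congrArg Fin.val hfj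
  simpa using this

/-- **the normal form of a homology array**: drop the zero row / column of the sorted bordered array -/
noncomputable def normalOf {d : Fin 13 → Fin 13 → ZMod 11} (h : QdmRows 11 13 d) (i j : Fin 12) : ZMod 11 :=
  border d (sortPerm (qdmRows_border h) (border_row0 d) i.succ) (sortPerm (qdmRows_border h) (border_row0 d) j.succ)

/-- **the normal form is normal** -/
theorem isNormal_normalOf {d : Fin 13 → Fin 13 → ZMod 11} (h : QdmRows 11 13 d) : IsNormal (normalOf h) := by
  have hb := qdmRows_border h
  have h0 := border_row0 d
  have hc0 := border_col0 d
  set σ := sortPerm hb h0 with hσ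
  have hQ : QdmRows 11 13 (fun i j => border d (σ i) (σ j)) := qdmRows_relabel hb σ
  have hσ0 : σ 0 = 0 := sortPerm_zero hb h0
  have hσ1 : σ 1 = 1 := sortPerm_one hb h0
  have s0 : ∀ i : Fin 12, i.succ ≠ (0 : Fin 13) := fun i => Fin.succ_ne_zero i
  have sinj : ∀ {i j : Fin 12}, i ≠ j → i.succ ≠ j.succ := fun hij e => hij (Fin.succ_injective _ e)
  refine ⟨?_, ?_, ?_, ?_⟩
  · -- row 0 sorted
    intro j hj
    show border d (σ (0 : Fin 12).succ) (σ j.succ) + 1 = _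
    rw [Fin.succ_zero_eq_one, hσ1]
    have hj1 : j.succ ≠ (1 : Fin 13) := fun e => hj (by
      have := congrArg Fin.val e; simp at this; exact Fin.ext (by simpa using this))
    have hs := row1_sorted hb h0 (s0 j) hj1
    have hv : ((border d 1 (σ j.succ)).val : ZMod 11) = border d 1 (σ j.succ) := ZMod.natCast_zmod_val _
    rw [← hv]
    have : ((j.succ : Fin 13) : ℕ) = (j : ℕ) + 1 := by simp
    rw [this] at hs
    have e2 : ((border d 1 (σ j.succ)).val : ZMod 11) + 2 = ((j : ℕ) : ZMod 11) + 1 := by exact_mod_cast congrArg (fun n : ℕ => (n : ZMod 11)) hs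
    linear_combination e2
  · -- rows injective off the hole (pair with row 0)
    intro i j j' hji hj'i hjj'
    have := hQ i.succ 0 (s0 i) j.succ j'.succ (sinj hjj') (sinj hji) (s0 j) (sinj hj'i) (s0 j')
    simp only [hσ0, h0, sub_zero] at this
    exact this
  · -- entries of different rows in a common column differ (pair of columns: j and 0)
    intro i i' j hii' hji hji'
    have := hQ i.succ i'.succ (sinj hii') j.succ 0 (s0 j) (sinj hji) (sinj hji') (s0 i).symm (s0 i').symm
    simp only [hσ0, hc0, sub_zero] at this
    intro e
    apply this
    change normalOf h i j - normalOf h i' j = 0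
    rw [e, sub_self]
  · -- differences pairwise distinct
    intro i i' hii' j j' hjj' hji hji' hj'i hj'i'
    exact hQ i.succ i'.succ (sinj hii') j.succ j'.succ (sinj hjj') (sinj hji) (sinj hji') (sinj hj'i) (sinj hj'i')

/-- **Case A of the order-11 cell reduces to the normal form**: if no `12 × 12` array is normal, `NoHomologyArray12` holds -/
theorem noHomologyArray12_of_normal (H : ∀ a : Fin 12 → Fin 12 → ZMod 11, ¬ IsNormal a) : NoHomologyArray12 :=
  fun _ h => H _ (isNormal_normalOf h)

end Homology12

end Summit.Ventures.DiscreteObjects.PP12
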